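import Summits.AtomisticToContinuum.FouriersLaw.Theorems.JunctionLocalityDefs
import Literature.MathematicalPhysics.KineticTheory.LangevinChainDynkin
import Literature.MathematicalPhysics.KineticTheory.ChainReflection

/-!
# Stub `stub_openChainGreenKubo` (GK) of line `contact-current-forgetting` — Aux 2: the response clause
# from the single-bond Kubo formula and flatness of the integrated Green–Kubo matrix

Helper file for crux `JunctionLocality.NonBallistic` (stmt-AtomisticToContinuum-9127), line
`contact-current-forgetting`, stub `stub_openChainGreenKubo` (= route item `HonestZwanzig.OpenChainGreenKubo`,
stmt-AtomisticToContinuum-12696).  The SECOND clause of the stub — the response of the steady total current at bath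
temperatures `(T + δ/2, T − δ/2)` tends, as `δ → 0`, `δ ≠ 0`, to `∫₀^∞ corr(J,J) / ((N−1)T²)` — contains the analytic
core of finite-`N` linear response for the hypoelliptic Langevin chain (differentiability at `δ = 0` of
`δ ↦ μ_{N,T+δ/2,T−δ/2}(j_i)`; items stmt-AtomisticToContinuum-0717 `FiniteResponseOfUnique` / 9144 `ResponseDensity`),
which is in the tree only as the Literature DEFINITION `OscillatorChain.KuboFormula` (Bonetto–Lebowitz–Rey-Bellet 2000
(32), single-bond diagonal form `lim μ_δ(j_i)/δ = T⁻² ∫₀^∞ μ_T(j_i · P_t j_i)`; "Eq. (32) … has not been proved").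
This file proves the honest REDUCTION of the clause to that definition, for the pinned chain `pinnedChain ω₂ lam β γ`
at fixed `(N, T)`, in the route vocabulary of `Theorems/JunctionLocalityDefs.lean`
(`gkEntry P N T b b' t = ⟨j_b, κ_t j_{b'}⟩_{μ_T}`, `totalCorr`):

* `tendsto_response_of_kuboFormula` — under weak-NESS uniqueness at `(N, T, T)`, the Kubo formula for the family `μ`
  with the CONSTRUCTED equilibrium semigroup `pinnedChainSemigroup` gives
  `lim_{δ→0,δ≠0} J_N(μ_δ)/δ = T⁻² Σ_{b<N−1} ∫₀^∞ M_N(b,b)` (the steady state at `(T,T)` is the Gibbs measure, the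
  semigroup acts by the kernels `transitionKernel N T T`, the last site carries no bond);
* `tendsto_response_greenKubo_of_kuboFormula_of_flat` (registered sub-goal, colon form) — if moreover the integrated
  Green–Kubo matrix has constant rows (`∫₀^∞ M_N(b,b') = ∫₀^∞ M_N(b,0)`, column flatness CF of the line) and is
  symmetric (`M_N(b,b')(t) = M_N(b',b)(t)`, Onsager symmetry from kernel detailed balance DB), and
  `corr(J,J) = Σ_{b,b'<N−1} M_N(b,b')` pointwise on `t ≥ 0`, then every integrated entry equals `m = ∫₀^∞ M_N(0,0)`, so
  `T⁻² Σ_b ∫₀^∞ M_N(b,b) = T⁻²(N−1)m = (N−1)²m/((N−1)T²) = ∫₀^∞ corr(J,J)/((N−1)T²)`: the stub's response clause.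

So GK = (KuboFormula along the family) + CF + DB-symmetry; the missing input is exactly `KuboFormula`.
-/

noncomputable section

open MeasureTheory Set Filter Topology
open scoped NNReal BigOperators

namespace Summit.AtomisticToContinuum.FouriersLaw.Theorems.NonBallistic

open Literature.MathematicalPhysics.KineticTheory.HeatConduction
open Summit.AtomisticToContinuum.FouriersLaw.Theorems.JunctionLocality

section Reduction

variable {ω₂ lam β γ : ℝ} (hω : 0 < ω₂) (hl : 0 < lam) (hβ : 0 < β) (hγ : 0 < γ) {T : ℝ} (hT : 0 < T)
  {N : ℕ} (hN0 : 0 < N)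

/-- **The Kubo formula, summed over the bonds.**  Under weak-NESS uniqueness at `(N, T, T)`, if the family `μ` is steady
at `(T, T)` and satisfies the finite-volume Kubo formula `OscillatorChain.KuboFormula` (BLR (32)) with the constructed
equilibrium semigroup `pinnedChainSemigroup`, then the response quotient of the total current converges:
`lim_{δ→0,δ≠0} J_N(μ_{T+δ/2,T−δ/2})/δ = T⁻² Σ_{b<N−1} ∫₀^∞ ⟨j_b, κ_t j_b⟩_{μ_T} dt` (`μ_{T,T} = μ_T` by uniqueness,
`pinnedChainSemigroup` acts by `transitionKernel N T T`, and `j_{N−1} ≡ 0`). [folklore] -/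
theorem tendsto_response_of_kuboFormula
    (huniq : ∀ μ ν : Measure (PhaseSpace N),
      (pinnedChain ω₂ lam β γ).IsSteadyState N T T μ →
      (pinnedChain ω₂ lam β γ).IsSteadyState N T T ν → μ = ν)
    (μ : ℝ → ℝ → Measure (PhaseSpace N)) (hμ : (pinnedChain ω₂ lam β γ).IsSteadyState N T T (μ T T))
    (hK : (pinnedChain ω₂ lam β γ).KuboFormula N T μ
      (pinnedChainSemigroup hω hl.le hβ.le hγ.le hN0 hT.le hT.le)) :
    Tendsto (fun δ : ℝ => (pinnedChain ω₂ lam β γ).totalCurrent (μ (T + δ / 2) (T - δ / 2)) / δ)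
      (𝓝[≠] 0)
      (𝓝 ((1 / T ^ 2) * ∑ b ∈ Finset.range (N - 1),
        ∫ t in Ioi (0 : ℝ), gkEntry (pinnedChain ω₂ lam β γ) N T b b t)) := by
  classical
  have hμT : μ T T = (pinnedChain ω₂ lam β γ).gibbsMeasure N T :=
    huniq _ _ hμ (pinnedChain_isSteadyState_gibbsMeasure hω hl.le hβ.le γ N hT)
  -- the Kubo integrand at bond `i` is the diagonal Green–Kubo entry `M_N(i,i)`
  have hentry : ∀ i : Fin N, (fun t : ℝ => ∫ z, (pinnedChain ω₂ lam β γ).bondCurrent N i z *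
      (pinnedChainSemigroup hω hl.le hβ.le hγ.le hN0 hT.le hT.le).act t.toNNReal
        ((pinnedChain ω₂ lam β γ).bondCurrent N i) z ∂(μ T T)) =
      fun t : ℝ => gkEntry (pinnedChain ω₂ lam β γ) N T i i t := by
    intro i
    funext t
    have hb : bondCurrentAt (pinnedChain ω₂ lam β γ) N i.val = (pinnedChain ω₂ lam β γ).bondCurrent N i := by
      funext z; rw [bondCurrentAt_eq_bondCurrent (pinnedChain ω₂ lam β γ) i.isLt]
    rw [gkEntry_def, hb, hμT]
    rfl
  -- per-bond limits
  set g : ℕ → ℝ := fun b => if b + 1 < N then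
    (1 / T ^ 2) * ∫ t in Ioi (0 : ℝ), gkEntry (pinnedChain ω₂ lam β γ) N T b b t else 0 with hg
  have hfun : (fun δ : ℝ => (pinnedChain ω₂ lam β γ).totalCurrent (μ (T + δ / 2) (T - δ / 2)) / δ) =
      fun δ : ℝ => ∑ i : Fin N,
        (∫ x, (pinnedChain ω₂ lam β γ).bondCurrent N i x ∂(μ (T + δ / 2) (T - δ / 2))) / δ := by
    funext δ
    simp only [OscillatorChain.totalCurrent, Finset.sum_div]
  have hsum : (1 / T ^ 2) * ∑ b ∈ Finset.range (N - 1),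
      ∫ t in Ioi (0 : ℝ), gkEntry (pinnedChain ω₂ lam β γ) N T b b t = ∑ i : Fin N, g i.val := by
    rw [Fin.sum_univ_eq_sum_range (fun b => g b) N, Finset.mul_sum]
    obtain ⟨n, rfl⟩ : ∃ n, N = n + 1 := ⟨N - 1, by omega⟩
    rw [Finset.sum_range_succ, Nat.add_sub_cancel]
    have hlast : g n = 0 := by
      simp only [hg]
      rw [if_neg (lt_irrefl _)]
    rw [hlast, add_zero]
    refine Finset.sum_congr rfl fun b hb => ?_
    have hb' : b + 1 < n + 1 := by have := Finset.mem_range.1 hb; omega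
    simp only [hg]
    rw [if_pos hb']
  rw [hfun, hsum]
  refine tendsto_finsetSum _ fun i _ => ?_
  by_cases hi : i.val + 1 < N
  · have h2 := (hK i hi).2
    rw [hentry i] at h2
    simp only [hg]
    rw [if_pos hi]
    exact h2
  · have h0 : ∀ δ : ℝ,
        (∫ x, (pinnedChain ω₂ lam β γ).bondCurrent N i x ∂(μ (T + δ / 2) (T - δ / 2))) / δ = 0 := by
      intro δ
      simp [(pinnedChain ω₂ lam β γ).bondCurrent_eq_zero_of_last N i (by have := i.isLt; omega)]
    simp only [h0, hg]
    rw [if_neg hi]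
    exact tendsto_const_nhds

end Reduction

/-- **GK's response clause from the Kubo formula and a flat, symmetric integrated Green–Kubo matrix.**  For the pinned
chain at `(N, T)`, `N ≥ 2`, `T > 0`: assume weak-NESS uniqueness at `(N, T, T)`, a family `μ` steady at `(T, T)`
satisfying `OscillatorChain.KuboFormula` with the constructed equilibrium semigroup (the open analytic core, items
stmt-0717 / 9144), the pointwise expansion `corr(J,J)(t) = Σ_{b,b'<N−1} M_N(b,b')(t)` (`t ≥ 0`), constant rows of the
integrated matrix with integrable entries (`∫₀^∞ M_N(b,b') = ∫₀^∞ M_N(b,0)`, column flatness), and Onsager symmetry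
`M_N(b,b')(t) = M_N(b',b)(t)` (`t ≥ 0`).  Then
`lim_{δ→0,δ≠0} J_N(μ_{T+δ/2,T−δ/2})/δ = ∫₀^∞ corr(J,J) / ((N−1)T²)` — every integrated entry equals `m = ∫₀^∞ M_N(0,0)`,
so the Kubo side is `T⁻²(N−1)m` and the Green–Kubo side is `(N−1)²m/((N−1)T²)`. [folklore] -/
theorem tendsto_response_greenKubo_of_kuboFormula_of_flat :
    ∀ (ω₂ lam β γ : ℝ) (hω : 0 < ω₂) (hl : 0 < lam) (hβ : 0 < β) (hγ : 0 < γ) (T : ℝ) (hT : 0 < T)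
      (N : ℕ) (hN0 : 0 < N), 2 ≤ N →
    (∀ μ ν : Measure (PhaseSpace N),
      (pinnedChain ω₂ lam β γ).IsSteadyState N T T μ →
      (pinnedChain ω₂ lam β γ).IsSteadyState N T T ν → μ = ν) →
    ∀ μ : ℝ → ℝ → Measure (PhaseSpace N), (pinnedChain ω₂ lam β γ).IsSteadyState N T T (μ T T) →
    (pinnedChain ω₂ lam β γ).KuboFormula N T μ (pinnedChainSemigroup hω hl.le hβ.le hγ.le hN0 hT.le hT.le) →
    (∀ t : ℝ, 0 ≤ t → totalCorr (pinnedChain ω₂ lam β γ) N T t =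
        ∑ b ∈ Finset.range (N - 1), ∑ b' ∈ Finset.range (N - 1), gkEntry (pinnedChain ω₂ lam β γ) N T b b' t) →
    (∀ b b' : ℕ, b + 1 < N → b' + 1 < N →
        IntegrableOn (gkEntry (pinnedChain ω₂ lam β γ) N T b b') (Ioi 0) ∧
        ∫ t in Ioi (0 : ℝ), gkEntry (pinnedChain ω₂ lam β γ) N T b b' t =
          ∫ t in Ioi (0 : ℝ), gkEntry (pinnedChain ω₂ lam β γ) N T b 0 t) →
    (∀ b b' : ℕ, ∀ t : ℝ, 0 ≤ t →
        gkEntry (pinnedChain ω₂ lam β γ) N T b b' t = gkEntry (pinnedChain ω₂ lam β γ) N T b' b t) →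
    Tendsto (fun δ : ℝ => (pinnedChain ω₂ lam β γ).totalCurrent (μ (T + δ / 2) (T - δ / 2)) / δ)
        (nhdsWithin 0 {(0 : ℝ)}ᶜ)
        (nhds ((∫ t in Ioi (0 : ℝ), totalCorr (pinnedChain ω₂ lam β γ) N T t) / (((N : ℝ) - 1) * T ^ 2))) := by
  intro ω₂ lam β γ hω hl hβ hγ T hT N hN0 hN huniq μ hμ hK hsum hflat hsymm
  set P := pinnedChain ω₂ lam β γ with hP
  have hA := tendsto_response_of_kuboFormula hω hl hβ hγ hT hN0 huniq μ hμ hK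
  have hN1 : (0 : ℝ) < (N : ℝ) - 1 := by
    have : (2 : ℝ) ≤ N := by exact_mod_cast hN
    linarith
  have hmemN : ∀ b ∈ Finset.range (N - 1), b + 1 < N := fun b hb => by
    have := Finset.mem_range.1 hb; omega
  have h0N : 0 + 1 < N := by omega
  -- integrability of every entry with both indices < N - 1
  have hint : ∀ b ∈ Finset.range (N - 1), ∀ b' ∈ Finset.range (N - 1),
      IntegrableOn (gkEntry P N T b b') (Ioi 0) := fun b hb b' hb' => (hflat b b' (hmemN b hb) (hmemN b' hb')).1
  -- every entry integrates to m = ∫ M(0,0)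
  have hentry : ∀ b ∈ Finset.range (N - 1), ∀ b' ∈ Finset.range (N - 1),
      ∫ t in Ioi (0 : ℝ), gkEntry P N T b b' t = ∫ t in Ioi (0 : ℝ), gkEntry P N T 0 0 t := by
    intro b hb b' hb'
    have e1 : ∫ t in Ioi (0 : ℝ), gkEntry P N T b b' t = ∫ t in Ioi (0 : ℝ), gkEntry P N T b 0 t :=
      (hflat b b' (hmemN b hb) (hmemN b' hb')).2
    have e2 : ∫ t in Ioi (0 : ℝ), gkEntry P N T b 0 t = ∫ t in Ioi (0 : ℝ), gkEntry P N T 0 b t :=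
      setIntegral_congr_fun measurableSet_Ioi fun t ht => hsymm b 0 t (le_of_lt ht)
    have e3 : ∫ t in Ioi (0 : ℝ), gkEntry P N T 0 b t = ∫ t in Ioi (0 : ℝ), gkEntry P N T 0 0 t :=
      (hflat 0 b h0N (hmemN b hb)).2
    rw [e1, e2, e3]
  -- ∫ corr = Σ_b Σ_b' ∫ M(b,b') = (N-1)² m
  have hI1 : ∫ t in Ioi (0 : ℝ), totalCorr P N T t =
      ∑ b ∈ Finset.range (N - 1), ∑ b' ∈ Finset.range (N - 1), ∫ t in Ioi (0 : ℝ), gkEntry P N T b b' t := by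
    have hcongr : ∫ t in Ioi (0 : ℝ), totalCorr P N T t =
        ∫ t in Ioi (0 : ℝ), ∑ b ∈ Finset.range (N - 1), ∑ b' ∈ Finset.range (N - 1), gkEntry P N T b b' t :=
      setIntegral_congr_fun measurableSet_Ioi fun t ht => hsum t (le_of_lt ht)
    rw [hcongr, integral_finsetSum _ fun b hb => ?_]
    · refine Finset.sum_congr rfl fun b hb => ?_
      rw [integral_finsetSum _ fun b' hb' => hint b hb b' hb']
    · exact integrable_finsetSum _ fun b' hb' => hint b hb b' hb'
  have hcast : ((N - 1 : ℕ) : ℝ) = (N : ℝ) - 1 := by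
    rw [Nat.cast_sub (by omega)]; simp
  have hI2 : ∫ t in Ioi (0 : ℝ), totalCorr P N T t =
      ((N : ℝ) - 1) ^ 2 * ∫ t in Ioi (0 : ℝ), gkEntry P N T 0 0 t := by
    rw [hI1, Finset.sum_congr rfl fun b hb => Finset.sum_congr rfl fun b' hb' => hentry b hb b' hb']
    simp only [Finset.sum_const, Finset.card_range, nsmul_eq_mul]
    rw [hcast]; ring
  -- the Kubo side: T⁻² Σ_b ∫ M(b,b) = T⁻² (N-1) m
  have hK2 : (1 / T ^ 2) * ∑ b ∈ Finset.range (N - 1), ∫ t in Ioi (0 : ℝ), gkEntry P N T b b t =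
      (1 / T ^ 2) * (((N : ℝ) - 1) * ∫ t in Ioi (0 : ℝ), gkEntry P N T 0 0 t) := by
    rw [Finset.sum_congr rfl fun b hb => hentry b hb b hb]
    simp only [Finset.sum_const, Finset.card_range, nsmul_eq_mul]
    rw [hcast]
  have hval : (∫ t in Ioi (0 : ℝ), totalCorr P N T t) / (((N : ℝ) - 1) * T ^ 2) =
      (1 / T ^ 2) * ∑ b ∈ Finset.range (N - 1), ∫ t in Ioi (0 : ℝ), gkEntry P N T b b t := by
    rw [hK2, hI2]
    field_simp
  rw [hval]
  exact hA

end Summit.AtomisticToContinuum.FouriersLaw.Theorems.NonBallistic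

end
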